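import Mathlib
import Summits.KontsevichZagierPeriods.KontsevichZagierPeriods.Theorems.InverseLandauTateLiftingSqrtAffineSector
import Summits.KontsevichZagierPeriods.KontsevichZagierPeriods.Theorems.InverseLandauTateLiftingPullback
import Literature.NumberTheory.Transcendental.KZDominatedFamilyRelations
import Literature.NumberTheory.Transcendental.KZSemiCanonicalReductionDimOne

/-!
# `TateLifting` (stmt-KontsevichZagierPeriods-9129), line `Sketch` — stub 38 `tateLifting_ratChart`

THE RATIONAL-CHART PULL-BACK (master lemma of the genus-zero sector). Let `K = ℚ̄ ∩ ℝ =
algebraicClosure ℚ ℝ` and let `r = [σ, f]` be a one-dimensional representation. Suppose a new variable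
`t = ψ(x)` is given which is a `ℚ`-semialgebraic function on `σ`, together with an INVERSE CHART
`X = p_X/q_X ∈ K(t)` (`q_X(ψ x) ≠ 0` and `X(ψ x) = x` on `σ`) and a rational pull-back `G = p_G/q_G ∈ K(t)`
of the integrand (`f(x) = G(ψ x)` on `σ`). Then `[σ, f]` differs by relations from an element of the
subgroup generated by the generators of the landed dimension-≤-1 algebraic sector
(`kzKernelConjecture_lowDimAlg`): ONE change of variables (Kontsevich–Zagier's rule (2), through the honest
pull-back `tateLifting_pullback_dimOne`) along `X : ψ(σ) → σ` produces `[ψ(σ), |X′(t)|·G(t)]`, and domain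
additivity along the sign of the numerator `N = p_X′ q_X − p_X q_X′` of `X′ = N/q_X²` splits it into two
representations read by the real polynomials `±(N p_G)` over `q_X² q_G` (all coefficients real algebraic)
and the zero-Jacobian piece `{N = 0}`, whose integrand vanishes. This is the common analytic step behind
Euler's substitutions for conics, the radicals `ⁿ√((ax+b)/(cx+e))`, and every other unirational
parametrisation of a genus-zero integrand.

References: M. Kontsevich, D. Zagier, *Periods* (2001), §1.2 rules (1), (2); J. Bochnak, M. Coste,
M.-F. Roy, *Real Algebraic Geometry* (1998), §2.2 (Tarski–Seidenberg).
-/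

noncomputable section

open MeasureTheory Set
open Literature.NumberTheory.Transcendental
open Literature.ModelTheory.ExponentialFields (IsSemialgebraic)

namespace Summit.KontsevichZagierPeriods.InverseLandau

namespace RatChart

/-- `y ↦ p(g y)` is `ℚ`-semialgebraic on `D ⊆ ℝ¹` for `p ∈ K[X]` (`K = ℚ̄ ∩ ℝ`) and `g` `ℚ`-semialgebraic
on `D`: induction on `p`, algebraic constants being `ℚ`-definable. [cite: KontsevichZagier2001, §1.1] -/
theorem rc_isSemialgebraicFunOn_aeval {D : Set (Fin 1 → ℝ)} (hD : IsSemialgebraic ℚ D)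
    {g : (Fin 1 → ℝ) → ℝ} (hg : IsSemialgebraicFunOn ℚ D g) (p : Polynomial (algebraicClosure ℚ ℝ)) :
    IsSemialgebraicFunOn ℚ D (fun y => (Polynomial.aeval (g y) p : ℝ)) := by
  induction p using Polynomial.induction_on' with
  | add p q hp hq =>
    refine (hp.fun_add hq).congr fun y _ => ?_
    simp
  | monomial n a =>
    refine ((isSemialgebraicFunOn_const_of_isAlgebraic hD (mem_algebraicClosure_iff.1 a.2)).fun_mul
      (hg.fun_pow n)).congr fun y _ => ?_
    simp [Polynomial.aeval_monomial, IntermediateField.algebraMap_apply]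

/-- Reading over `ℝ`: `(p.map (K → ℝ)).eval t = p(t)` for `p ∈ K[X]`. [folklore] -/
theorem rc_eval_map (p : Polynomial (algebraicClosure ℚ ℝ)) (t : ℝ) :
    (p.map (algebraMap (algebraicClosure ℚ ℝ) ℝ)).eval t = (Polynomial.aeval t p : ℝ) := by
  rw [Polynomial.eval_map, Polynomial.aeval_def]

end RatChart

open RatChart in
/-- **The rational-chart pull-back** (stub 38 `tateLifting_ratChart` of the lead's skeleton): for a
dimension-one representation `r = [σ, f]`, a `ℚ`-semialgebraic new variable `t = ψ(x)` on `σ`, an inverse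
chart `X = p_X/q_X ∈ K(t)` (`q_X(ψ x) ≠ 0`, `X(ψ x) = x` on `σ`) and `G = p_G/q_G ∈ K(t)` with
`f(x) = G(ψ x)` on `σ`, there is `ℓ` in the subgroup generated by the low-dimensional algebraic generators
with `[σ, f] − ℓ ∈ KZ.relations`: pull back along `X` (rule (2)), split along the sign of the numerator of
`X′` (rule (1)), discard the zero-Jacobian piece. [cite: KontsevichZagier2001, §1.2 rule (2)] -/
theorem tateLifting_ratChart :
    ∀ (r : KZ.IntegralRep 1) (ψ : ℝ → ℝ) (pX qX pG qG : Polynomial (algebraicClosure ℚ ℝ)),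
      IsSemialgebraicFunOn ℚ r.domain (fun x => ψ (x 0)) →
      (∀ x ∈ r.domain, (Polynomial.aeval (ψ (x 0)) qX : ℝ) ≠ 0) →
      (∀ x ∈ r.domain, (Polynomial.aeval (ψ (x 0)) pX : ℝ) / Polynomial.aeval (ψ (x 0)) qX = x 0) →
      (∀ x ∈ r.domain, (Polynomial.aeval (ψ (x 0)) qG : ℝ) ≠ 0) →
      (∀ x ∈ r.domain, r.integrand x =
        (Polynomial.aeval (ψ (x 0)) pG : ℝ) / Polynomial.aeval (ψ (x 0)) qG) →
      ∃ ℓ ∈ AddSubgroup.closure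
          {d : KZ.FormalRep | (∃ r : KZ.IntegralRep 0, d = KZ.of r) ∨
            ∃ (r : KZ.IntegralRep 1) (p q : Polynomial ℝ), (∀ i, IsAlgebraic ℚ (p.coeff i)) ∧
              (∀ i, IsAlgebraic ℚ (q.coeff i)) ∧ (∀ x ∈ r.domain, q.eval (x 0) ≠ 0) ∧
              Set.EqOn r.integrand (fun x => p.eval (x 0) / q.eval (x 0)) r.domain ∧ d = KZ.of r},
        KZ.of r - ℓ ∈ KZ.relations := by
  intro r ψ pX qX pG qG hψ hqX hX hqG hG
  -- the chart `X`, its derivative `X' = N/q_X²`, the pulled-back integrand `G`, the new domain `D = ψ(σ)`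
  set N : Polynomial (algebraicClosure ℚ ℝ) :=
    Polynomial.derivative pX * qX - pX * Polynomial.derivative qX with hN_def
  set X : ℝ → ℝ := fun t => (Polynomial.aeval t pX : ℝ) / Polynomial.aeval t qX with hX_def
  set X' : ℝ → ℝ := fun t => (Polynomial.aeval t N : ℝ) / (Polynomial.aeval t qX) ^ 2 with hX'_def
  set G : ℝ → ℝ := fun t => (Polynomial.aeval t pG : ℝ) / Polynomial.aeval t qG with hG_def
  set Ψ : (Fin 1 → ℝ) → (Fin 1 → ℝ) := fun y => fun _ => ψ (y 0) with hΨ_def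
  set D : Set (Fin 1 → ℝ) := Ψ '' r.domain with hD_def
  have hσ : IsSemialgebraic ℚ r.domain := r.isSemialgebraic_domain
  have hΨ : IsSemialgebraicMapOn ℚ r.domain Ψ := IsSemialgebraicMapOn.of_forall hσ fun _ => hψ
  have hD : IsSemialgebraic ℚ D := IsSemialgebraicMapOn.isSemialgebraic_image_holds hΨ Subset.rfl hσ
  have hqXD : ∀ y ∈ D, (Polynomial.aeval (y 0) qX : ℝ) ≠ 0 := by
    rintro _ ⟨x, hx, rfl⟩
    exact hqX x hx
  have hqGD : ∀ y ∈ D, (Polynomial.aeval (y 0) qG : ℝ) ≠ 0 := by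
    rintro _ ⟨x, hx, rfl⟩
    exact hqG x hx
  have hXψ : ∀ x ∈ r.domain, X (ψ (x 0)) = x 0 := fun x hx => hX x hx
  -- the chart is semialgebraic, differentiable, injective, onto `σ`
  have hΦsa : IsSemialgebraicFunOn ℚ D (fun y => X (y 0)) :=
    (rc_isSemialgebraicFunOn_aeval hD (isSemialgebraicFunOn_apply hD 0) pX).div
      (rc_isSemialgebraicFunOn_aeval hD (isSemialgebraicFunOn_apply hD 0) qX) hqXD
  have hderiv : ∀ y ∈ D, HasDerivAt X (X' (y 0)) (y 0) := fun y hy => by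
    have h := (Polynomial.hasDerivAt_aeval pX (y 0)).div (Polynomial.hasDerivAt_aeval qX (y 0))
      (hqXD y hy)
    refine h.congr_deriv ?_
    show _ = (Polynomial.aeval (y 0) N : ℝ) / (Polynomial.aeval (y 0) qX) ^ 2
    rw [hN_def, map_sub, map_mul, map_mul]
  have hinj : InjOn (fun y : Fin 1 → ℝ => fun _ : Fin 1 => X (y 0)) D := by
    rintro _ ⟨x₁, h₁, rfl⟩ _ ⟨x₂, h₂, rfl⟩ h
    have h' : X (ψ (x₁ 0)) = X (ψ (x₂ 0)) := congr_fun h 0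
    rw [hXψ x₁ h₁, hXψ x₂ h₂] at h'
    have h12 : x₁ = x₂ := by rw [← (KZ.eq_const_apply_zero x₁).symm, ← (KZ.eq_const_apply_zero x₂).symm, h']
    rw [h12]
  have himage : (fun y : Fin 1 → ℝ => fun _ : Fin 1 => X (y 0)) '' D = r.domain := by
    refine Set.ext fun x => ⟨?_, fun hx => ⟨Ψ x, ⟨x, hx, rfl⟩, ?_⟩⟩
    · rintro ⟨_, ⟨x', hx', rfl⟩, rfl⟩
      show (fun _ => X (ψ (x' 0))) ∈ r.domain
      rw [hXψ x' hx', ← KZ.eq_const_apply_zero]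
      exact hx'
    · show (fun _ => X (ψ (x 0))) = x
      rw [hXψ x hx, ← KZ.eq_const_apply_zero]
  have hNsa : IsSemialgebraicFunOn ℚ D (fun y => (Polynomial.aeval (y 0) N : ℝ)) :=
    rc_isSemialgebraicFunOn_aeval hD (isSemialgebraicFunOn_apply hD 0) N
  have hX'sa : IsSemialgebraicFunOn ℚ D (fun y => X' (y 0)) :=
    hNsa.div ((rc_isSemialgebraicFunOn_aeval hD (isSemialgebraicFunOn_apply hD 0) qX).fun_pow 2)
      fun y hy => pow_ne_zero 2 (hqXD y hy)
  have hJ : IsSemialgebraicFunOn ℚ D (fun y => |X' (y 0)|) := hX'sa.abs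
  -- ONE change of variables: the honest pull-back `r' = [D, |X'|·(f ∘ X)]`
  obtain ⟨r', hdom', hint', hrel'⟩ := tateLifting_pullback_dimOne r D X X' (fun y => |X' (y 0)|) hD
    hΦsa hderiv hinj himage hJ (fun y _ => rfl)
  have hint'D : ∀ y ∈ D, r'.integrand y = |X' (y 0)| * G (y 0) := by
    rintro y ⟨x, hx, rfl⟩
    rw [hint']
    show |X' (ψ (x 0))| * r.integrand (fun _ => X (ψ (x 0))) = |X' (ψ (x 0))| * G (ψ (x 0))
    rw [hXψ x hx, ← KZ.eq_const_apply_zero, hG x hx]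
  -- split `D` along the sign of `N`
  set Dp : Set (Fin 1 → ℝ) := {y | y ∈ D ∧ 0 < (Polynomial.aeval (y 0) N : ℝ)} with hDp_def
  set Dm : Set (Fin 1 → ℝ) := {y | y ∈ D ∧ (Polynomial.aeval (y 0) N : ℝ) < 0} with hDm_def
  set Dz : Set (Fin 1 → ℝ) := {y | y ∈ D ∧ (Polynomial.aeval (y 0) N : ℝ) = 0} with hDz_def
  have hDp : IsSemialgebraic ℚ Dp := by
    convert hNsa.neg.isSemialgebraic_sep_neg using 1
    ext y
    simp [hDp_def]
  have hDm : IsSemialgebraic ℚ Dm := hNsa.isSemialgebraic_sep_neg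
  have hDz : IsSemialgebraic ℚ Dz :=
    isSemialgebraic_sep_eq hNsa (isSemialgebraicFunOn_const_of_isAlgebraic hD isAlgebraic_zero)
  have hDps : Dp ⊆ r'.domain := by rw [hdom']; exact fun y hy => hy.1
  have hDms : Dm ⊆ r'.domain := by rw [hdom']; exact fun y hy => hy.1
  have hDzs : Dz ⊆ r'.domain := by rw [hdom']; exact fun y hy => hy.1
  have hDzms : Dz ∪ Dm ⊆ r'.domain := union_subset hDzs hDms
  set rp := r'.restrict Dp hDp hDps with hrp
  set rm := r'.restrict Dm hDm hDms with hrm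
  set rz := r'.restrict Dz hDz hDzs with hrz
  set rzm := r'.restrict (Dz ∪ Dm) (hDz.union hDm) hDzms with hrzm
  -- domain additivity, twice
  have hsplit1 : KZ.of r' - KZ.of rp - KZ.of rzm ∈ KZ.relations := by
    refine KZ.domainAddRel_subset_relations ⟨1, r', rp, rzm, ?_, ?_, fun _ _ => rfl, fun _ _ => rfl, rfl⟩
    · show r'.domain = Dp ∪ (Dz ∪ Dm)
      rw [hdom']
      refine Set.ext fun y => ⟨fun hy => ?_, ?_⟩
      · rcases lt_trichotomy 0 (Polynomial.aeval (y 0) N : ℝ) with h | h | h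
        · exact Or.inl ⟨hy, h⟩
        · exact Or.inr (Or.inl ⟨hy, h.symm⟩)
        · exact Or.inr (Or.inr ⟨hy, h⟩)
      · rintro (hy | hy | hy) <;> exact hy.1
    · show volume (Dp ∩ (Dz ∪ Dm)) = 0
      rw [show Dp ∩ (Dz ∪ Dm) = ∅ from Set.ext fun y => ⟨fun hy => ?_, fun hy => hy.elim⟩,
        measure_empty]
      rcases hy.2 with h | h
      · exact absurd h.2 hy.1.2.ne'
      · exact absurd (hy.1.2.trans h.2) (lt_irrefl _)
  have hsplit2 : KZ.of rzm - KZ.of rz - KZ.of rm ∈ KZ.relations := by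
    refine KZ.domainAddRel_subset_relations ⟨1, rzm, rz, rm, rfl, ?_, fun _ _ => rfl, fun _ _ => rfl, rfl⟩
    show volume (Dz ∩ Dm) = 0
    rw [show Dz ∩ Dm = ∅ from Set.ext fun y => ⟨fun hy => ?_, fun hy => hy.elim⟩, measure_empty]
    exact absurd hy.1.2 hy.2.2.ne
  -- the zero-Jacobian piece is a relation
  have hz : KZ.of rz ∈ KZ.relations := by
    refine KZ.of_mem_relations_of_eqOn_zero rz fun y hy => ?_
    show r'.integrand y = 0
    rw [hint'D y hy.1, hX'_def]
    simp only [hy.2, zero_div, abs_zero, zero_mul]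
  -- the two signed pieces are generators of the low-dimensional algebraic sector
  have hreading : ∀ (ε : ℝ) (y : Fin 1 → ℝ), y ∈ D → |X' (y 0)| = ε * X' (y 0) →
      r'.integrand y = ((Polynomial.C ε * (N * pG).map (algebraMap (algebraicClosure ℚ ℝ) ℝ)).eval (y 0)) /
        ((qX ^ 2 * qG).map (algebraMap (algebraicClosure ℚ ℝ) ℝ)).eval (y 0) := by
    intro ε y hy hε
    rw [hint'D y hy, hε, Polynomial.eval_mul, Polynomial.eval_C, rc_eval_map, rc_eval_map, hX'_def,
      hG_def]
    simp only [map_mul, map_pow]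
    have h1 := hqXD y hy
    have h2 := hqGD y hy
    field_simp
  have hdenom : ∀ y ∈ D, ((qX ^ 2 * qG).map (algebraMap (algebraicClosure ℚ ℝ) ℝ)).eval (y 0) ≠ 0 := by
    intro y hy
    rw [rc_eval_map, map_mul, map_pow]
    exact mul_ne_zero (pow_ne_zero 2 (hqXD y hy)) (hqGD y hy)
  have halg : ∀ (ε : ℝ), IsAlgebraic ℚ ε → ∀ i, IsAlgebraic ℚ
      ((Polynomial.C ε * (N * pG).map (algebraMap (algebraicClosure ℚ ℝ) ℝ)).coeff i) := by
    intro ε hε i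
    rw [Polynomial.coeff_C_mul]
    exact hε.mul (DimOne.uc_isAlgebraic_coeff _ i)
  have hsq : ∀ y ∈ D, (0 : ℝ) < (Polynomial.aeval (y 0) qX : ℝ) ^ 2 := fun y hy =>
    lt_of_le_of_ne (sq_nonneg _) (pow_ne_zero 2 (hqXD y hy)).symm
  have hgenp : KZ.of rp ∈ {d : KZ.FormalRep | (∃ r : KZ.IntegralRep 0, d = KZ.of r) ∨
      ∃ (r : KZ.IntegralRep 1) (p q : Polynomial ℝ), (∀ i, IsAlgebraic ℚ (p.coeff i)) ∧
        (∀ i, IsAlgebraic ℚ (q.coeff i)) ∧ (∀ x ∈ r.domain, q.eval (x 0) ≠ 0) ∧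
        Set.EqOn r.integrand (fun x => p.eval (x 0) / q.eval (x 0)) r.domain ∧ d = KZ.of r} := by
    refine Or.inr ⟨rp, _, _, halg 1 isAlgebraic_one, DimOne.uc_isAlgebraic_coeff _,
      fun y hy => hdenom y hy.1, fun y hy => hreading 1 y hy.1 ?_, rfl⟩
    rw [one_mul]
    exact abs_of_pos (div_pos hy.2 (hsq y hy.1))
  have hgenm : KZ.of rm ∈ {d : KZ.FormalRep | (∃ r : KZ.IntegralRep 0, d = KZ.of r) ∨
      ∃ (r : KZ.IntegralRep 1) (p q : Polynomial ℝ), (∀ i, IsAlgebraic ℚ (p.coeff i)) ∧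
        (∀ i, IsAlgebraic ℚ (q.coeff i)) ∧ (∀ x ∈ r.domain, q.eval (x 0) ≠ 0) ∧
        Set.EqOn r.integrand (fun x => p.eval (x 0) / q.eval (x 0)) r.domain ∧ d = KZ.of r} := by
    refine Or.inr ⟨rm, _, _, halg (-1) isAlgebraic_one.neg, DimOne.uc_isAlgebraic_coeff _,
      fun y hy => hdenom y hy.1, fun y hy => hreading (-1) y hy.1 ?_, rfl⟩
    rw [neg_one_mul]
    exact abs_of_neg (div_neg_of_neg_of_pos hy.2 (hsq y hy.1))
  -- assemble: `[r] − ([rp] + [rm]) = ([r] − [r']) + ([r'] − [rp] − [rzm]) + ([rzm] − [rz] − [rm]) + [rz]`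
  refine ⟨KZ.of rp + KZ.of rm,
    add_mem (AddSubgroup.subset_closure hgenp) (AddSubgroup.subset_closure hgenm), ?_⟩
  have h := KZ.relations.add_mem (KZ.relations.add_mem (KZ.relations.add_mem hrel' hsplit1) hsplit2) hz
  convert h using 1
  abel

end Summit.KontsevichZagierPeriods.InverseLandau

end
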